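import Summits.Parity.GeneralizedHardyLittlewood.Theorems.GreenTaoLevelTwoGITwoCyclicInverseBracketArithmetic

/-!
# Route `GreenTaoLevelTwo`, crux `GITwo` (stmt-Parity-21275), line `birth`, stub `stub_cyclicInverse`:
# re-indexing `ℤ/Nℤ` by the representatives `−N/2 ≤ n ≤ N/2` (GT08a arXiv Thm. 68, "`F_{N,g,x₀}(n) :=
# F(T_gⁿ x₀)` for all `−N/2 < n < N/2`")

Seventy-third helper file toward the XL stub `stub_cyclicInverse` (B. Green, T. Tao, *An inverse
theorem for the Gowers `U³(G)` norm*, arXiv:math/0503014, Thm. 68 = PEMS 51 (2008) Thm. 12.8).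
Block E17: the stub's correlation is `∑_{n ∈ Icc(−N/2, N/2)} f(n + h) F(gⁿ x₀)`, while the
realisation lemmas (`…FactorRealisations`, `…QuadMonomial`, `…LinearMonomial`) give `F(gⁿx₀)` as a
function of `x = n mod N`; for `N` odd the representatives `−(N−1)/2 ≤ n ≤ (N−1)/2` hit every
residue exactly once.  Def-free:

* `intCast_injOn_Icc` — `n ↦ n mod N` is injective on `Icc (−(N/2)) (N/2)` (`N` odd);
* `sum_Icc_intCast_eq_sum_univ` — `∑_{n ∈ Icc(−(N/2),N/2)} G(n mod N) = ∑_{x : ℤ/Nℤ} G x` (`N` odd);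
* `sum_univ_eq_sum_Icc_valMinAbs` — the same read backwards with `n = valMinAbs x`:
  `∑_x H x (valMinAbs x) = ∑_{n ∈ Icc} H (n mod N) n`.

References: [GreenTao2008U3Inverse] arXiv:math/0503014, §12, Thm. 68 (the definition of `F_{N,g,x₀}`).
-/

namespace Summit.Parity.GeneralizedHardyLittlewood.GreenTaoLevelTwoGITwoCyclicInverse

open Finset

/-- For `N` odd, `valMinAbs x ∈ [−(N/2), N/2]`. [folklore] -/
theorem valMinAbs_mem_Icc {N : ℕ} [NeZero N] (x : ZMod N) :
    x.valMinAbs ∈ Finset.Icc (-((N : ℤ) / 2)) ((N : ℤ) / 2) := by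
  rw [Finset.mem_Icc]
  have h1 : x.valMinAbs.natAbs ≤ N / 2 := ZMod.natAbs_valMinAbs_le x
  have h2 : ((N / 2 : ℕ) : ℤ) = (N : ℤ) / 2 := by omega
  constructor <;> omega

/-- For `N` odd, `n ↦ n mod N` is injective on the representatives `−(N/2) ≤ n ≤ N/2`. [folklore] -/
theorem intCast_injOn_Icc {N : ℕ} [NeZero N] (hN : Odd N) :
    Set.InjOn (fun n : ℤ => (n : ZMod N)) (Finset.Icc (-((N : ℤ) / 2)) ((N : ℤ) / 2) : Set ℤ) := by
  intro n hn m hm hnm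
  simp only [Finset.coe_Icc, Set.mem_Icc] at hn hm
  have hnm' : (n : ZMod N) = (m : ZMod N) := hnm
  have h : ((n - m : ℤ) : ZMod N) = 0 := by rw [Int.cast_sub, hnm', sub_self]
  rw [ZMod.intCast_zmod_eq_zero_iff_dvd] at h
  obtain ⟨k, hk⟩ := h
  obtain ⟨r, hr⟩ := hN
  have hN2 : (N : ℤ) / 2 = r := by omega
  rw [hN2] at hn hm
  have hNz : (N : ℤ) = 2 * r + 1 := by omega
  rw [hNz] at hk
  have hr0 : (0 : ℤ) ≤ r := by positivity
  have hk0 : k = 0 := by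
    by_contra hk0
    rcases lt_or_gt_of_ne hk0 with hlt | hgt
    · have hk1 : k ≤ -1 := by omega
      have : (2 * (r : ℤ) + 1) * k ≤ (2 * r + 1) * (-1) :=
        mul_le_mul_of_nonneg_left hk1 (by positivity)
      linarith [hn.1, hm.2]
    · have hk1 : 1 ≤ k := by omega
      have : (2 * (r : ℤ) + 1) * 1 ≤ (2 * r + 1) * k :=
        mul_le_mul_of_nonneg_left hk1 (by positivity)
      linarith [hn.2, hm.1]
  rw [hk0, mul_zero, sub_eq_zero] at hk
  exact hk

/-- **Re-indexing by representatives**: for `N` odd and any `G : ℤ/Nℤ → M`,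
`∑_{n ∈ Icc(−(N/2), N/2)} G(n mod N) = ∑_{x : ℤ/Nℤ} G x`.
[cite: GreenTao2008U3Inverse, §12, Thm. 68 (definition of F_{N,g,x₀})] -/
theorem sum_Icc_intCast_eq_sum_univ {N : ℕ} [NeZero N] (hN : Odd N) {M : Type*} [AddCommMonoid M]
    (G : ZMod N → M) :
    ∑ n ∈ Finset.Icc (-((N : ℤ) / 2)) ((N : ℤ) / 2), G (n : ZMod N) = ∑ x : ZMod N, G x := by
  refine Finset.sum_nbij' (fun n : ℤ => (n : ZMod N)) (fun x : ZMod N => x.valMinAbs)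
    (fun n _ => Finset.mem_univ _) (fun x _ => valMinAbs_mem_Icc x) (fun n hn => ?_)
    (fun x _ => ZMod.coe_valMinAbs x) (fun n _ => rfl)
  -- left inverse: `valMinAbs (n mod N) = n` for a representative `n`
  exact intCast_injOn_Icc hN (valMinAbs_mem_Icc _) (Finset.mem_coe.2 hn) (ZMod.coe_valMinAbs _)

/-- The same with the representative available to the summand:
`∑_x H x (valMinAbs x) = ∑_{n ∈ Icc(−(N/2),N/2)} H (n mod N) n` (`N` odd).
[cite: GreenTao2008U3Inverse, §12, Thm. 68 (definition of F_{N,g,x₀})] -/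
theorem sum_univ_eq_sum_Icc_valMinAbs {N : ℕ} [NeZero N] (hN : Odd N) {M : Type*} [AddCommMonoid M]
    (H : ZMod N → ℤ → M) :
    ∑ x : ZMod N, H x x.valMinAbs =
      ∑ n ∈ Finset.Icc (-((N : ℤ) / 2)) ((N : ℤ) / 2), H (n : ZMod N) n := by
  rw [← sum_Icc_intCast_eq_sum_univ hN]
  refine Finset.sum_congr rfl fun n hn => ?_
  rw [intCast_injOn_Icc hN (valMinAbs_mem_Icc _) (Finset.mem_coe.2 hn) (ZMod.coe_valMinAbs _)]

end Summit.Parity.GeneralizedHardyLittlewood.GreenTaoLevelTwoGITwoCyclicInverse
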